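import Literature.Barriers.ABC.BakerMethodBoundsYuInput
import Summits.ABC.ABC.Theses.IneffectiveSubspace

/-!
# `UniformSadicTowerFour` (stmt-ABC-14937), line `flat-steep-split` (lead c4): what p-adic LFL gives
# towards UPD(1,2) — Yu's two-logarithm wall (factor `p/(log p)²`) and UPD per FIXED prime triple

Calibration file of line `flat-steep-split` for the crux `UniformSadicTowerFour` (route
`IneffectiveSubspace`), lead c4, wave 2.  Lead c4's normal form of the first OPEN rung `W = 3` of
BoundedOmegaABC (the crux modulo the route's crux #6) is the **one-prime / two-base divisibility
bound** UPD(1,2): for every `ε > 0` there is `C = C(ε)` such that for pairwise distinct primes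
`p, q, r` and `Y, Z, t ∈ ℕ`, if `p^t ∣ q^Y r^Z − 1` (with `q^Y r^Z ≥ 2`) or `p^t ∣ r^Z − q^Y` (with
`q^Y < r^Z`), then `p^t ≤ C · (pqr)^(1+ε) · (q^Y r^Z)^ε` (landed: crux ⟹ UPD(1,2), p155800;
UPD(1,2) ⟹ rung 3, p156267; sibling file `…OnePrimeOfPadicTwoLog`: the UNIFORM two-logarithm
conjecture V ⟹ UPD(1,2)).  This file records what the one vendored effective `p`-adic input of the
tree — **Yu's theorem on linear forms in `p`-adic logarithms over `ℚ`** (Evertse–Győry 2015,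
Thm. 3.2.7 = Yu 2007), the NAMED FACT `Literature.Barriers.ABC.yu2007_padicLogForm_rat` (UNPROVED
in the tree; taken here as the hypothesis `hY`, never proved) — gives towards UPD(1,2):

* (a) `onePrimeTwoBase_fixed_of_logWall` — unconditional real analysis: for a FIXED prime triple a
  log-wall `t · log p ≤ K₁ · log(max(Y,Z) + 2) + K₂` under the divisibility hypotheses implies
  UPD(1,2) for that triple (constant `C(K₁, K₂, ε)`);
* (b) `onePrime_logWall_of_yu2007` — CONDITIONAL on `hY`: the uniform two-logarithm WALL
  `t ≤ K · (p/(log p)²) · log q · log r · log(pqr · (max(Y,Z) + 2))` for all distinct primes, with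
  one absolute constant `K = 101 · C₃(3,1)` (`C₃(n,1)` Yu's constant; not optimised);
* (c) `onePrimeTwoBase_fixed_of_yu2007` — CONDITIONAL on `hY`: UPD(1,2) for every FIXED triple of
  distinct primes, the constant depending on `(p, q, r, ε)` ((a) applied to the wall (b)).

So, granted Yu's theorem, the OPEN content of UPD(1,2) is pure UNIFORMITY in the primes: the wall
(b) misses the needed `(1+ε) log(pqr) + κ log(max(Y,Z)+2) + C` exactly by the factor `p/(log p)²` in
front of `log q log r` — the "residue-field defect" of the idea card
`Summits/ABC/ABC/Ideas/three-prime-powers-padic-exponent.md` ("per fixed bases everything is in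
hand; the `p`-dependence is the one missing thing").  (b), (c) depend on the unproved named
fact only through the explicit binder `hY` (conditional results; no axiom, no `sorry`).

**Proofs.**  (a) WLOG `K₁ ≥ 0`; with `B = max(Y,Z)`, `q^Y r^Z ≥ 2^B` gives
`H := log(q^Y r^Z) ≥ B log 2`, and `K₁ log(B+2) ≤ ε B log 2 + C₁(K₁, ε)` (`η = ε log 2/(K₁+1)`,
`log y ≤ y − 1` at `y = η(B+2)`); so `t log p ≤ ε H + C₁ + K₂`, and exponentiate
(`p^t = exp(t log p)`, `x^ε = exp(ε log x)`, `(pqr)^{1+ε} ≥ 1`).  (b) Apply `hY` with THREE indices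
`α = (q, r, 1)`, `b = (Y, e, 1)`, `e = Z` (product form) resp. `e = −Z` (difference form), the
distinguished index being the torsion one (`b = 1`: Yu's `p`-adic ordering condition on `b` is then
void), `B = max(Y,Z) + 2`, `Bₙ = 1`, `δ = 1/(2B)`.  Then `Λ = q^Y r^e − 1` equals `q^Y r^Z − 1 ∈ ℕ`
resp. `−(r^Z − q^Y)/r^Z`, so `ord_p Λ = v_p(q^Y r^Z − 1)` resp. `v_p(r^Z − q^Y)` (`p ≠ r`) `≥ t`;
the heights are `h'(q) = log q`, `h'(r) = log r`, `h'(1) = 1/(16e²)`; Yu's bound reads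
`t < C₃(3,1) (p/(log p)²) max{log q log r (16e²)⁻¹ log(2B C₅(3,1) p⁴ log q log r), 1/(2C₄(3,1))}`,
and `log C₅ ≤ 93`, `C₄ ≥ 1`, `log p, log log q, log log r, log 2, log B ≤ L := log(pqrB) ≥ 1`
bound the `max` by `101 log q log r L` (`yu_wall_arith`).  (c) For fixed `p, q, r` the wall
is `t log p ≤ K₁ log(max(Y,Z)+2) + K₂`, `K₁ = K (p/(log p)²) log q log r log p`, `K₂ = K₁ log(pqr)`.

Sources: [EvertseGyory2015] J.-H. Evertse, K. Győry, *Unit Equations in Diophantine Number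
Theory*, CUP 2015, Thm. 3.2.7 (p. 62) (= K. Yu, Forum Math. 19 (2007), Main Theorem, second
consequence), as vendored in `Literature.Barriers.ABC.BakerMethodBoundsYuInput`, with the constant
lemmas `yuC3_nonneg`, `one_le_yuC4`, `yuC5_pos`, `log_yuC5_le` (`…Thm328Proofs`); the idea card
above; Mathlib (`Rat.logHeight₁_natCast`, `Height.logHeight₁_one`, `padicValNat_dvd_iff_le`,
`padicValRat.div/.neg/.pow/.of_nat`, `padicValNat_primes`, `Real.log_le_sub_one_of_pos`,
`Real.rpow_def_of_pos`).  No new definitions.  Deliberately NOT here: UPD(1,2) uniformly in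
`(p, q, r)` (OPEN — the rung itself), the conjecture V, and the named fact itself.
-/

noncomputable section

-- `Summit.<Summit>.<Problem>` is the mandated summit-side namespace (CONVENTIONS §2); for the
-- single-conjunct summit `ABC` the two coincide, so the duplicate `ABC.ABC` is deliberate.
set_option linter.dupNamespace false

namespace Summit.ABC.ABC.Theorems.UniformSadicTowerFour.BoundedOmega

open Literature.Barriers.ABC (yu2007_padicLogForm_rat)
open Literature.NumberTheory.DiophantineGeometry.Dioph (yuC3_nonneg yuC5_pos log_yuC5_le
  one_le_yuC4)
open Finset Real Height

/-! ## (a) Pure analysis: a log-wall for a fixed prime triple gives UPD(1,2) for that triple -/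

/-- Growth lemma: `K log(B + 2) ≤ ε B log 2 + C(K, ε)` for all naturals `B` (`K ≥ 0`, `ε > 0`):
with `η = ε log 2 / (K + 1)`, `log(B + 2) = log(η (B + 2)) − log η ≤ η (B + 2) − 1 − log η`.
[folklore] -/
private theorem logWall_growth {K ε : ℝ} (hK : 0 ≤ K) (hε : 0 < ε) :
    ∃ C : ℝ, ∀ B : ℕ, K * Real.log ((B + 2 : ℕ) : ℝ) ≤ ε * ((B : ℝ) * Real.log 2) + C := by
  have hlog2 : 0 < Real.log 2 := Real.log_pos one_lt_two
  obtain ⟨η, hη⟩ : ∃ η : ℝ, η = ε * Real.log 2 / (K + 1) := ⟨_, rfl⟩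
  have hη0 : 0 < η := by rw [hη]; positivity
  refine ⟨K * (2 * η - 1 - Real.log η), fun B => ?_⟩
  rw [show ((B + 2 : ℕ) : ℝ) = (B : ℝ) + 2 by push_cast; ring]
  have hB0 : (0 : ℝ) ≤ B := Nat.cast_nonneg B
  have hB2 : (0 : ℝ) < (B : ℝ) + 2 := by positivity
  have h2 : Real.log (η * ((B : ℝ) + 2)) ≤ η * ((B : ℝ) + 2) - 1 :=
    Real.log_le_sub_one_of_pos (by positivity)
  rw [Real.log_mul hη0.ne' hB2.ne'] at h2
  have h3 : Real.log ((B : ℝ) + 2) ≤ η * B + (2 * η - 1 - Real.log η) := by linarith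
  have h4 : K * η ≤ ε * Real.log 2 := by
    have h5 : K / (K + 1) ≤ 1 := (div_le_one (by linarith)).mpr (by linarith)
    calc K * η = K / (K + 1) * (ε * Real.log 2) := by rw [hη]; field_simp
      _ ≤ 1 * (ε * Real.log 2) := by gcongr
      _ = ε * Real.log 2 := one_mul _
  calc K * Real.log ((B : ℝ) + 2) ≤ K * (η * B + (2 * η - 1 - Real.log η)) :=
        mul_le_mul_of_nonneg_left h3 hK
    _ = (K * η) * B + K * (2 * η - 1 - Real.log η) := by ring
    _ ≤ (ε * Real.log 2) * B + K * (2 * η - 1 - Real.log η) := by gcongr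
    _ = ε * ((B : ℝ) * Real.log 2) + K * (2 * η - 1 - Real.log η) := by ring

/-- Pure analysis: a log-wall `t log p ≤ K₁ log(max(Y,Z)+2) + K₂` for a FIXED prime triple gives
UPD(1,2) for that triple, `p^t ≤ C (pqr)^{1+ε} (q^Y r^Z)^ε` — because `log(q^Y r^Z) ≥ max(Y,Z) log 2`
(`q^Y r^Z ≥ 2^{max(Y,Z)}`) dominates `K₁ log(max(Y,Z) + 2)` (`logWall_growth`). [folklore] -/
theorem onePrimeTwoBase_fixed_of_logWall {p q r : ℕ} (hp : p.Prime) (hq : q.Prime) (hr : r.Prime)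
    (hW : ∃ K₁ K₂ : ℝ, ∀ Y Z t : ℕ,
      (p ^ t ∣ q ^ Y * r ^ Z - 1 ∧ 2 ≤ q ^ Y * r ^ Z) ∨ (p ^ t ∣ r ^ Z - q ^ Y ∧ q ^ Y < r ^ Z) →
      (t : ℝ) * Real.log p ≤ K₁ * Real.log (max Y Z + 2 : ℕ) + K₂) :
    ∀ ε : ℝ, 0 < ε → ∃ C : ℝ, 0 < C ∧ ∀ Y Z t : ℕ,
      (p ^ t ∣ q ^ Y * r ^ Z - 1 ∧ 2 ≤ q ^ Y * r ^ Z) ∨ (p ^ t ∣ r ^ Z - q ^ Y ∧ q ^ Y < r ^ Z) →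
      ((p ^ t : ℕ) : ℝ) ≤ C * ((p * q * r : ℕ) : ℝ) ^ (1 + ε) * ((q ^ Y * r ^ Z : ℕ) : ℝ) ^ ε := by
  obtain ⟨K₁, K₂, hW⟩ := hW
  intro ε hε
  have hK0 : 0 ≤ max K₁ 0 := le_max_right _ _
  obtain ⟨C₁, hC₁⟩ := logWall_growth hK0 hε
  refine ⟨Real.exp (C₁ + K₂), Real.exp_pos _, fun Y Z t h => ?_⟩
  have hp0 : (0 : ℝ) < p := by exact_mod_cast hp.pos
  -- `2^{max(Y,Z)} ≤ q^Y r^Z`, so `max(Y,Z) log 2 ≤ log(q^Y r^Z)`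
  have hN : 2 ^ max Y Z ≤ q ^ Y * r ^ Z := by
    rcases le_total Y Z with hle | hle
    · rw [max_eq_right hle]
      exact (Nat.pow_le_pow_left hr.two_le Z).trans
        (Nat.le_mul_of_pos_left _ (Nat.one_le_pow _ _ hq.pos))
    · rw [max_eq_left hle]
      exact (Nat.pow_le_pow_left hq.two_le Y).trans
        (Nat.le_mul_of_pos_right _ (Nat.one_le_pow _ _ hr.pos))
  have hNpos : (0 : ℝ) < ((q ^ Y * r ^ Z : ℕ) : ℝ) := by
    exact_mod_cast (Nat.two_pow_pos _).trans_le hN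
  have hlogN : ((max Y Z : ℕ) : ℝ) * Real.log 2 ≤ Real.log ((q ^ Y * r ^ Z : ℕ) : ℝ) := by
    have h2 : ((2 ^ max Y Z : ℕ) : ℝ) ≤ ((q ^ Y * r ^ Z : ℕ) : ℝ) := by exact_mod_cast hN
    calc ((max Y Z : ℕ) : ℝ) * Real.log 2 = Real.log ((2 ^ max Y Z : ℕ) : ℝ) := by
          rw [Nat.cast_pow, Real.log_pow]; norm_num
      _ ≤ Real.log ((q ^ Y * r ^ Z : ℕ) : ℝ) := Real.log_le_log (by positivity) h2
  -- the wall, with `K₁ ≤ max K₁ 0`, and the growth lemma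
  have hlog0 : 0 ≤ Real.log ((max Y Z + 2 : ℕ) : ℝ) :=
    Real.log_nonneg (by exact_mod_cast (by omega : 1 ≤ max Y Z + 2))
  have h1 := mul_le_mul_of_nonneg_right (le_max_left K₁ 0) hlog0
  have h2 := mul_le_mul_of_nonneg_left hlogN hε.le
  have h3 : (t : ℝ) * Real.log p ≤ ε * Real.log ((q ^ Y * r ^ Z : ℕ) : ℝ) + (C₁ + K₂) := by
    linarith [hW Y Z t h, hC₁ (max Y Z)]
  -- exponentiate
  have hpt : ((p ^ t : ℕ) : ℝ) = Real.exp ((t : ℝ) * Real.log p) := by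
    rw [Nat.cast_pow, ← Real.rpow_natCast, Real.rpow_def_of_pos hp0, mul_comm]
  have hNε : ((q ^ Y * r ^ Z : ℕ) : ℝ) ^ ε = Real.exp (ε * Real.log ((q ^ Y * r ^ Z : ℕ) : ℝ)) := by
    rw [Real.rpow_def_of_pos hNpos, mul_comm]
  have hrad : (1 : ℝ) ≤ ((p * q * r : ℕ) : ℝ) ^ (1 + ε) := by
    refine Real.one_le_rpow ?_ (by linarith)
    exact_mod_cast Nat.one_le_iff_ne_zero.mpr (by simp [hp.ne_zero, hq.ne_zero, hr.ne_zero])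
  calc ((p ^ t : ℕ) : ℝ) = Real.exp ((t : ℝ) * Real.log p) := hpt
    _ ≤ Real.exp (ε * Real.log ((q ^ Y * r ^ Z : ℕ) : ℝ) + (C₁ + K₂)) := Real.exp_le_exp.mpr h3
    _ = Real.exp (C₁ + K₂) * 1 * ((q ^ Y * r ^ Z : ℕ) : ℝ) ^ ε := by
        rw [Real.exp_add, hNε]; ring
    _ ≤ Real.exp (C₁ + K₂) * ((p * q * r : ℕ) : ℝ) ^ (1 + ε) * ((q ^ Y * r ^ Z : ℕ) : ℝ) ^ ε := by
        gcongr

/-! ## (b) Yu 2007 (two logarithms + one torsion index, over `ℚ`) ⟹ the uniform two-log wall -/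

/-- The real-analysis step behind the wall: Yu's right-hand side, instantiated with three indices
(`α = (q, r, 1)`, `Bₙ = 1`, `δ = 1/(2B)`, `h'(q) = log q`, `h'(r) = log r`, `h'(1) = 1/(16e²)`), is at
most `101 · C₃ · (p/(log p)²) · log q · log r · L` whenever `L ≥ 1` dominates `log p`, `log q`,
`log r`, `log B` (`log C₅(3,1) ≤ 93`, `C₄(3,1) ≥ 1`). [folklore] -/
private theorem yu_wall_arith {v C3 C4 C5 P x Ly Lz B L : ℝ} (hC3 : 0 ≤ C3) (hC4 : 1 ≤ C4)
    (hC5 : 0 < C5) (hlogC5 : Real.log C5 ≤ 93) (hP : 0 ≤ P) (hx : 0 < x) (hLy : Real.log 2 ≤ Ly)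
    (hLz : Real.log 2 ≤ Lz) (hB : 0 < B) (hL1 : 1 ≤ L) (hxL : Real.log x ≤ L) (hLyL : Ly ≤ L)
    (hLzL : Lz ≤ L) (hBL : Real.log B ≤ L)
    (hv : v < C3 * P *
      max (Ly * Lz * (1 / (16 * Real.exp 1 ^ 2)) *
            Real.log (1 * C5 * x ^ (3 + 1) * (Ly * Lz) / (1 / (2 * B))))
          (1 / (2 * B) * B / (1 * C4))) :
    v ≤ 101 * C3 * P * Ly * Lz * L := by
  have hlog2 : (1 / 2 : ℝ) < Real.log 2 := by have := Real.log_two_gt_d9; linarith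
  have hLy0 : 0 < Ly := by linarith
  have hLz0 : 0 < Lz := by linarith
  have hL0 : 0 < L := by linarith
  have hc1 : 1 / (16 * Real.exp 1 ^ 2) ≤ 1 := by
    rw [div_le_one (by positivity)]
    nlinarith [Real.add_one_le_exp (1 : ℝ)]
  -- the logarithm of `M/δ = 2 B C₅ p⁴ log q log r`
  have hM : Real.log (1 * C5 * x ^ (3 + 1) * (Ly * Lz) / (1 / (2 * B))) ≤ 101 * L := by
    have heq : 1 * C5 * x ^ (3 + 1) * (Ly * Lz) / (1 / (2 * B)) = C5 * x ^ 4 * Ly * Lz * 2 * B := by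
      field_simp
    rw [heq, Real.log_mul (by positivity) hB.ne', Real.log_mul (by positivity) two_ne_zero,
      Real.log_mul (by positivity) hLz0.ne', Real.log_mul (by positivity) hLy0.ne',
      Real.log_mul hC5.ne' (by positivity), Real.log_pow]
    have h1 : Real.log Ly ≤ L := (Real.log_le_sub_one_of_pos hLy0).trans (by linarith)
    have h2 : Real.log Lz ≤ L := (Real.log_le_sub_one_of_pos hLz0).trans (by linarith)
    push_cast
    linarith
  have hT1 : Ly * Lz * (1 / (16 * Real.exp 1 ^ 2)) *
      Real.log (1 * C5 * x ^ (3 + 1) * (Ly * Lz) / (1 / (2 * B))) ≤ 101 * (Ly * Lz * L) := by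
    have hLLc : 0 ≤ Ly * Lz * (1 / (16 * Real.exp 1 ^ 2)) := by positivity
    calc Ly * Lz * (1 / (16 * Real.exp 1 ^ 2)) *
          Real.log (1 * C5 * x ^ (3 + 1) * (Ly * Lz) / (1 / (2 * B)))
        ≤ Ly * Lz * (1 / (16 * Real.exp 1 ^ 2)) * (101 * L) := mul_le_mul_of_nonneg_left hM hLLc
      _ ≤ Ly * Lz * 1 * (101 * L) := by gcongr
      _ = 101 * (Ly * Lz * L) := by ring
  have hT2 : 1 / (2 * B) * B / (1 * C4) ≤ 101 * (Ly * Lz * L) := by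
    have heq : 1 / (2 * B) * B / (1 * C4) = 1 / (2 * C4) := by field_simp
    have h1 : 1 / (2 * C4) ≤ 1 := by rw [div_le_one (by positivity)]; linarith
    have h4 : (1 / 2) * (1 / 2) * 1 ≤ Ly * Lz * L :=
      mul_le_mul (mul_le_mul (by linarith) (by linarith) (by norm_num) hLy0.le) hL1 (by norm_num)
        (by positivity)
    rw [heq]; linarith
  have hfin := lt_of_lt_of_le hv (mul_le_mul_of_nonneg_left (max_le hT1 hT2) (mul_nonneg hC3 hP))
  linarith

/-- **Yu's theorem instantiated** (Evertse–Győry Thm. 3.2.7 over `ℚ` with three indices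
`α = (q, r, 1)`, `b = (Y, e, 1)`, `|e| ≤ Z`, distinguished index the torsion one — so the `p`-adic
ordering condition on `b` is void — `B = max(Y,Z) + 2`, `Bₙ = 1`, `δ = 1/(2B)`): for primes
`p, q, r` and `Λ = q^Y r^e − 1 ≠ 0`,
`ord_p Λ ≤ 101 C₃(3,1) · (p/(log p)²) · log q · log r · log(pqr(max(Y,Z)+2))`.  CONDITIONAL on the
named fact `yu2007_padicLogForm_rat` (binder `hY`). [cite: EvertseGyory2015, Thm 3.2.7 (p. 62)] -/
theorem padicValRat_twoPrimes_le_of_yu2007 (hY : yu2007_padicLogForm_rat) {p q r : ℕ}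
    (hp : p.Prime) (hq : q.Prime) (hr : r.Prime) (Y Z : ℕ) (e : ℤ) (he : |e| ≤ (Z : ℤ))
    (hΛ : (q : ℚ) ^ (Y : ℤ) * (r : ℚ) ^ e - 1 ≠ 0) :
    (padicValRat p ((q : ℚ) ^ (Y : ℤ) * (r : ℚ) ^ e - 1) : ℝ) ≤
      101 * ((16 * Real.exp 1) ^ (2 * (3 + 1)) * ((3 : ℕ) : ℝ) ^ (3 / 2 : ℝ) *
          Real.log (2 * ((3 : ℕ) : ℝ)) * Real.log 2) *
        ((p : ℝ) / Real.log p ^ 2) * Real.log q * Real.log r *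
        Real.log (p * q * r * (max Y Z + 2) : ℕ) := by
  obtain ⟨B, hB⟩ : ∃ B : ℝ, B = ((max Y Z + 2 : ℕ) : ℝ) := ⟨_, rfl⟩
  have hB2 : (2 : ℝ) ≤ B := by rw [hB]; exact_mod_cast (le_add_self : 2 ≤ max Y Z + 2)
  have hB0 : 0 < B := by linarith
  have hp0 : (0 : ℝ) < p := by exact_mod_cast hp.pos
  have hq0 : (0 : ℝ) < q := by exact_mod_cast hq.pos
  have hr0 : (0 : ℝ) < r := by exact_mod_cast hr.pos
  have hp2 : (2 : ℝ) ≤ p := by exact_mod_cast hp.two_le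
  have hq2 : (2 : ℝ) ≤ q := by exact_mod_cast hq.two_le
  have hr2 : (2 : ℝ) ≤ r := by exact_mod_cast hr.two_le
  -- the size `L = log(pqrB)` dominates `1`, `log p`, `log q`, `log r`, `log B`
  have hX : ((p * q * r * (max Y Z + 2) : ℕ) : ℝ) = (p : ℝ) * q * r * B := by
    rw [hB]; simp only [Nat.cast_mul]
  rw [hX]
  have h4 : ∀ {x y : ℝ}, 2 ≤ x → 2 ≤ y → 4 ≤ x * y := fun hx hy =>
    calc (4 : ℝ) = 2 * 2 := by norm_num
      _ ≤ _ := mul_le_mul hx hy (by norm_num) (by linarith)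
  have h8 : ∀ {x y z : ℝ}, 2 ≤ x → 2 ≤ y → 2 ≤ z → 8 ≤ x * y * z := fun hx hy hz =>
    calc (8 : ℝ) = 4 * 2 := by norm_num
      _ ≤ _ := mul_le_mul (h4 hx hy) hz (by norm_num) (by linarith [h4 hx hy])
  have hX16 : (16 : ℝ) ≤ (p : ℝ) * q * r * B :=
    calc (16 : ℝ) = 8 * 2 := by norm_num
      _ ≤ _ := mul_le_mul (h8 hp2 hq2 hr2) hB2 (by norm_num) (by linarith [h8 hp2 hq2 hr2])
  have hXpos : (0 : ℝ) < (p : ℝ) * q * r * B := by linarith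
  have hL1 : (1 : ℝ) ≤ Real.log ((p : ℝ) * q * r * B) := by
    rw [Real.le_log_iff_exp_le hXpos]
    linarith [Real.exp_one_lt_d9]
  have hxL : Real.log p ≤ Real.log ((p : ℝ) * q * r * B) := by
    refine Real.log_le_log hp0 ?_
    calc (p : ℝ) ≤ p * (q * r * B) := le_mul_of_one_le_right hp0.le (by linarith [h8 hq2 hr2 hB2])
      _ = _ := by ring
  have hLyL : Real.log q ≤ Real.log ((p : ℝ) * q * r * B) := by
    refine Real.log_le_log hq0 ?_
    calc (q : ℝ) ≤ q * (p * r * B) := le_mul_of_one_le_right hq0.le (by linarith [h8 hp2 hr2 hB2])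
      _ = _ := by ring
  have hLzL : Real.log r ≤ Real.log ((p : ℝ) * q * r * B) := by
    refine Real.log_le_log hr0 ?_
    calc (r : ℝ) ≤ r * (p * q * B) := le_mul_of_one_le_right hr0.le (by linarith [h8 hp2 hq2 hB2])
      _ = _ := by ring
  have hBL : Real.log B ≤ Real.log ((p : ℝ) * q * r * B) :=
    Real.log_le_log hB0 (le_mul_of_one_le_left hB0.le (by linarith [h8 hp2 hq2 hr2]))
  have hP : (0 : ℝ) ≤ (p : ℝ) / Real.log p ^ 2 := by positivity
  -- the modified heights `h'(q) = log q`, `h'(r) = log r`, `h'(1) = 1/(16e²)`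
  have h16 : 1 / (16 * Real.exp 1 ^ 2) ≤ Real.log 2 := by
    have he1 : (1 : ℝ) ≤ Real.exp 1 ^ 2 := one_le_pow₀ (by linarith [Real.add_one_le_exp (1 : ℝ)])
    calc 1 / (16 * Real.exp 1 ^ 2) ≤ 1 / 16 := one_div_le_one_div_of_le (by norm_num) (by nlinarith)
      _ ≤ Real.log 2 := by linarith [Real.log_two_gt_d9]
  have hlq : Real.log 2 ≤ Real.log q := Real.log_le_log two_pos hq2
  have hlr : Real.log 2 ≤ Real.log r := Real.log_le_log two_pos hr2
  have hhq : max (logHeight₁ (q : ℚ)) (1 / (16 * Real.exp 1 ^ 2)) = Real.log q := by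
    haveI : NeZero q := ⟨hq.ne_zero⟩
    rw [Rat.logHeight₁_natCast, max_eq_left (h16.trans hlq)]
  have hhr : max (logHeight₁ (r : ℚ)) (1 / (16 * Real.exp 1 ^ 2)) = Real.log r := by
    haveI : NeZero r := ⟨hr.ne_zero⟩
    rw [Rat.logHeight₁_natCast, max_eq_left (h16.trans hlr)]
  have hh1 : max (logHeight₁ (1 : ℚ)) (1 / (16 * Real.exp 1 ^ 2)) = 1 / (16 * Real.exp 1 ^ 2) := by
    rw [logHeight₁_one, max_eq_right (by positivity)]
  -- the data for Theorem 3.2.7 on `Fin 3`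
  set α : Fin 3 → ℚ := ![(q : ℚ), r, 1] with hαdef
  set b : Fin 3 → ℤ := ![(Y : ℤ), e, 1] with hbdef
  have hα0 : ∀ k, α k ≠ 0 := by
    intro k; fin_cases k <;> simp [α, hq.ne_zero, hr.ne_zero]
  have hord : ∀ k, b k ≠ 0 → padicValInt p (b 2) ≤ padicValInt p (b k) := by
    intro k _; simp [b]
  have hbB : ∀ k, (|b k| : ℝ) ≤ B := by
    have hY' : (Y : ℝ) ≤ B := by rw [hB]; exact_mod_cast (by omega : Y ≤ max Y Z + 2)
    have hZ' : (Z : ℝ) ≤ B := by rw [hB]; exact_mod_cast (by omega : Z ≤ max Y Z + 2)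
    have he' : |(e : ℝ)| ≤ (Z : ℝ) := by rw [← Int.cast_abs]; exact_mod_cast he
    intro k; fin_cases k
    · simp [b]; exact hY'
    · simp [b]; linarith
    · simp [b]; linarith
  have hprodΛ : ∏ k, α k ^ b k - 1 = (q : ℚ) ^ (Y : ℤ) * (r : ℚ) ^ e - 1 := by
    simp [Fin.prod_univ_three, α, b]
  have hΛ' : ∏ k, α k ^ b k - 1 ≠ 0 := by rw [hprodΛ]; exact hΛ
  have hδ : 1 / (2 * B) ≤ 1 / 2 := one_div_le_one_div_of_le two_pos (by linarith)
  have hfull : ∏ k, max (logHeight₁ (α k)) (1 / (16 * Real.exp 1 ^ 2)) =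
      Real.log q * Real.log r * (1 / (16 * Real.exp 1 ^ 2)) := by
    rw [Fin.prod_univ_three]
    simp only [α, Matrix.cons_val_zero, Matrix.cons_val_one, Matrix.head_cons, Matrix.cons_val_two,
      Matrix.tail_cons, hhq, hhr, hh1]
  have herase : ∏ k ∈ univ.erase (2 : Fin 3), max (logHeight₁ (α k)) (1 / (16 * Real.exp 1 ^ 2)) =
      Real.log q * Real.log r := by
    have h01 : (univ : Finset (Fin 3)).erase 2 = {0, 1} := by decide
    rw [h01, Finset.prod_pair (by decide)]
    simp only [α, Matrix.cons_val_zero, Matrix.cons_val_one, hhq, hhr]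
  -- apply Theorem 3.2.7 and conclude by `yu_wall_arith`
  have hYu := hY (Fin 3) (by simp) α b 2 B 1 (1 / (2 * B)) p hp hα0 (by simp [b]) hord hbB
    (by linarith) (by simp [b]) hΛ' (by positivity) hδ
  rw [hprodΛ, hfull, herase, Fintype.card_fin] at hYu
  exact yu_wall_arith (yuC3_nonneg 3 (by norm_num)) (one_le_yuC4 3 (by norm_num)) (yuC5_pos 3)
    ((log_yuC5_le 3).trans (by norm_num)) hP hp0 hlq hlr hB0 hL1 hxL hLyL hLzL hBL hYu

/-- Yu 2007 (`n = 2` over `ℚ`; Evertse–Győry Thm. 3.2.7) ⟹ the uniform two-log WALL for the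
one-prime form: if `p^t ∣ q^Y r^Z − 1` or `p^t ∣ r^Z − q^Y > 0` (distinct primes), the exponent `t` is
at most `K · p/(log p)² · log q · log r · log(pqr(max(Y,Z)+2))` with an absolute `K`
(`= 101 C₃(3,1)`): `ord_p Λ ≥ t` for `Λ = q^Y r^{±Z} − 1` and `padicValRat_twoPrimes_le_of_yu2007`.
CONDITIONAL on the named fact `yu2007_padicLogForm_rat` (binder `hY`).
[cite: EvertseGyory2015, Thm 3.2.7 (p. 62)] -/
theorem onePrime_logWall_of_yu2007 (hY : yu2007_padicLogForm_rat) :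
    ∃ K : ℝ, 0 < K ∧ ∀ p q r : ℕ, p.Prime → q.Prime → r.Prime → p ≠ q → p ≠ r → q ≠ r →
      ∀ Y Z t : ℕ,
      (p ^ t ∣ q ^ Y * r ^ Z - 1 ∧ 2 ≤ q ^ Y * r ^ Z) ∨ (p ^ t ∣ r ^ Z - q ^ Y ∧ q ^ Y < r ^ Z) →
      (t : ℝ) ≤ K * ((p : ℝ) / Real.log p ^ 2) * Real.log q * Real.log r *
        Real.log (p * q * r * (max Y Z + 2) : ℕ) := by
  have hC3 : (0 : ℝ) < (16 * Real.exp 1) ^ (2 * (3 + 1)) * ((3 : ℕ) : ℝ) ^ (3 / 2 : ℝ) *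
      Real.log (2 * ((3 : ℕ) : ℝ)) * Real.log 2 := by
    have h1 : (0 : ℝ) < ((3 : ℕ) : ℝ) ^ (3 / 2 : ℝ) := Real.rpow_pos_of_pos (by norm_num) _
    have h2 : (0 : ℝ) < Real.log (2 * ((3 : ℕ) : ℝ)) := Real.log_pos (by norm_num)
    have h3 : (0 : ℝ) < Real.log 2 := Real.log_pos one_lt_two; positivity
  refine ⟨101 * ((16 * Real.exp 1) ^ (2 * (3 + 1)) * ((3 : ℕ) : ℝ) ^ (3 / 2 : ℝ) *
      Real.log (2 * ((3 : ℕ) : ℝ)) * Real.log 2), by positivity, ?_⟩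
  intro p q r hp hq hr hpq hpr hqr Y Z t h
  haveI := Fact.mk hp; haveI := Fact.mk hr
  rcases h with ⟨hdvd, h2⟩ | ⟨hdvd, hlt⟩
  · -- the product form `p^t ∣ q^Y r^Z − 1`: `Λ = q^Y r^Z − 1 ∈ ℕ`
    have hN1 : 1 ≤ q ^ Y * r ^ Z := by omega
    have hN0 : q ^ Y * r ^ Z - 1 ≠ 0 := by omega
    have ht : t ≤ padicValNat p (q ^ Y * r ^ Z - 1) := (padicValNat_dvd_iff_le hN0).mp hdvd
    have hΛeq : (q : ℚ) ^ (Y : ℤ) * (r : ℚ) ^ ((Z : ℕ) : ℤ) - 1 =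
        ((q ^ Y * r ^ Z - 1 : ℕ) : ℚ) := by
      rw [zpow_natCast, zpow_natCast, Nat.cast_sub hN1]; push_cast; ring
    have hΛne : (q : ℚ) ^ (Y : ℤ) * (r : ℚ) ^ ((Z : ℕ) : ℤ) - 1 ≠ 0 := by
      rw [hΛeq]; exact_mod_cast hN0
    have hcore := padicValRat_twoPrimes_le_of_yu2007 hY hp hq hr Y Z (Z : ℤ) (by simp) hΛne
    rw [hΛeq, padicValRat.of_nat] at hcore
    have ht' : (t : ℝ) ≤ ((padicValNat p (q ^ Y * r ^ Z - 1) : ℤ) : ℝ) := by exact_mod_cast ht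
    exact ht'.trans hcore
  · -- the difference form `p^t ∣ r^Z − q^Y > 0`: `Λ = q^Y r^{−Z} − 1 = −(r^Z − q^Y)/r^Z`
    have hD0 : r ^ Z - q ^ Y ≠ 0 := Nat.sub_ne_zero_of_lt hlt
    have ht : t ≤ padicValNat p (r ^ Z - q ^ Y) := (padicValNat_dvd_iff_le hD0).mp hdvd
    have hrZ : (r : ℚ) ^ Z ≠ 0 := pow_ne_zero _ (by exact_mod_cast hr.ne_zero)
    have hDq : -((r ^ Z - q ^ Y : ℕ) : ℚ) ≠ 0 := neg_ne_zero.mpr (by exact_mod_cast hD0)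
    have hΛeq : (q : ℚ) ^ (Y : ℤ) * (r : ℚ) ^ (-((Z : ℕ) : ℤ)) - 1 =
        -((r ^ Z - q ^ Y : ℕ) : ℚ) / (r : ℚ) ^ Z := by
      rw [zpow_neg, zpow_natCast, zpow_natCast, Nat.cast_sub hlt.le]; push_cast; field_simp; ring
    have hΛne : (q : ℚ) ^ (Y : ℤ) * (r : ℚ) ^ (-((Z : ℕ) : ℤ)) - 1 ≠ 0 := by
      rw [hΛeq]; exact div_ne_zero hDq hrZ
    have hval : padicValRat p (-((r ^ Z - q ^ Y : ℕ) : ℚ) / (r : ℚ) ^ Z) =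
        padicValNat p (r ^ Z - q ^ Y) := by
      rw [padicValRat.div hDq hrZ, padicValRat.neg, padicValRat.of_nat, padicValRat.pow,
        padicValRat.of_nat, padicValNat_primes hpr]
      simp
    have hcore := padicValRat_twoPrimes_le_of_yu2007 hY hp hq hr Y Z (-((Z : ℕ) : ℤ)) (by simp) hΛne
    rw [hΛeq, hval] at hcore
    have ht' : (t : ℝ) ≤ ((padicValNat p (r ^ Z - q ^ Y) : ℤ) : ℝ) := by exact_mod_cast ht
    exact ht'.trans hcore

/-! ## (c) Hence UPD(1,2) for every FIXED prime triple, conditional on Yu 2007 -/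

/-- Yu 2007 ⟹ UPD(1,2) for every FIXED triple of distinct primes (constant depending on
`p, q, r, ε`): the wall (b) for this triple reads `t log p ≤ K₁ log(max(Y,Z)+2) + K₂` with
`K₁ = K (p/(log p)²) log q log r log p`, `K₂ = K₁ log(pqr)`, and (a) applies.  So the OPEN content of
UPD(1,2) is exactly the UNIFORMITY in `(p, q, r)` (the factor `p/(log p)²` where `log p`-strength is
needed: the "residue-field defect").  CONDITIONAL on the named fact `yu2007_padicLogForm_rat`.
[cite: EvertseGyory2015, Thm 3.2.7 (p. 62)] -/
theorem onePrimeTwoBase_fixed_of_yu2007 (hY : yu2007_padicLogForm_rat) {p q r : ℕ} (hp : p.Prime)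
    (hq : q.Prime) (hr : r.Prime) (hpq : p ≠ q) (hpr : p ≠ r) (hqr : q ≠ r) :
    ∀ ε : ℝ, 0 < ε → ∃ C : ℝ, 0 < C ∧ ∀ Y Z t : ℕ,
      (p ^ t ∣ q ^ Y * r ^ Z - 1 ∧ 2 ≤ q ^ Y * r ^ Z) ∨ (p ^ t ∣ r ^ Z - q ^ Y ∧ q ^ Y < r ^ Z) →
      ((p ^ t : ℕ) : ℝ) ≤ C * ((p * q * r : ℕ) : ℝ) ^ (1 + ε) * ((q ^ Y * r ^ Z : ℕ) : ℝ) ^ ε := by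
  obtain ⟨K, -, hwall⟩ := onePrime_logWall_of_yu2007 hY
  refine onePrimeTwoBase_fixed_of_logWall hp hq hr
    ⟨K * ((p : ℝ) / Real.log p ^ 2) * Real.log q * Real.log r * Real.log p,
     K * ((p : ℝ) / Real.log p ^ 2) * Real.log q * Real.log r * Real.log p *
       Real.log (p * q * r : ℕ), fun Y Z t h => ?_⟩
  have h1 := hwall p q r hp hq hr hpq hpr hqr Y Z t h
  have hlogp : 0 < Real.log p := Real.log_pos (by exact_mod_cast hp.one_lt)
  have hpqr : (0 : ℝ) < ((p * q * r : ℕ) : ℝ) := by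
    exact_mod_cast Nat.mul_pos (Nat.mul_pos hp.pos hq.pos) hr.pos
  have hm : (0 : ℝ) < ((max Y Z + 2 : ℕ) : ℝ) := by positivity
  rw [Nat.cast_mul, Real.log_mul hpqr.ne' hm.ne'] at h1
  have h2 := mul_le_mul_of_nonneg_right h1 hlogp.le
  linarith

end Summit.ABC.ABC.Theorems.UniformSadicTowerFour.BoundedOmega

end
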